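import Mathlib
import HarnessLib

/-!
# Identity-theorem bookkeeping on `ℍ` for the C3 witness: equalities off a thin closed set hold everywhere
(route `ManinLocalTwoThree`, crux C3 `ManinPrimeToThreeAtNine` stmt-BirchSwinnertonDyer-22968; cell bsd-f2-manin, C3 LEAD p1 gen 15;
`--supports stmt-BirchSwinnertonDyer-22968`; Mathlib only)

Piece (INV) `UDCKummerWitnessLine.KummerMinimalWitnessInvariance` of -an's witness line (C3 skeleton v25 `stub_kummerMinimalWitnessInvariance`) compares
`F ∣[k] γ` with `ρ_γ • F` for a holomorphic `F : ℍ → ℂ` that is only KNOWN (as `C₀·kummerMinBlock·kummerPoleKiller`) off the thin set `Z = B ∪ φ⁻¹(O)`.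
This file is the generic analytic-continuation bookkeeping:

* `eq_of_eventuallyEq` — two holomorphic functions on `ℍ` that agree near one point agree everywhere (identity theorem; `ℍ` is connected);
* `eq_of_eqOn_compl` — … that agree off a closed set with empty interior agree everywhere;
* `slash_eq_smul_of_eqOn_compl` — `F ∣[k] g = ρ • F` off such a set ⟹ everywhere (`MDifferentiable.slash`);
* `isClosed_zeroSet` / `interior_zeroSet_eq_empty` — the zero set of a holomorphic `H ≢ 0` on `ℍ` is closed with empty interior, also for
  `τ ↦ H (g • τ)` (`zeroSet_smul`); `interior_union_eq_empty` — finite unions stay thin.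

HONEST FRAMING.  Bookkeeping only; (INV), C3, Manin's conjecture and BSD are NOT proved here.  No definitions, no sorry. [folklore]
-/

set_option autoImplicit false
-- lint-debt: the directory name repeats the summit name (sibling precedent `ManinLocalTwoThreeUDCGlue.lean`)
set_option linter.dupNamespace false

noncomputable section

open Complex Filter Function Set UpperHalfPlane ModularForm
open scoped Real Topology Manifold MatrixGroups ModularForm

namespace Summit.BirchSwinnertonDyer.BirchSwinnertonDyer.Theorems.ManinLocalTwoThree.HolomorphicIdentity

variable {F G : ℍ → ℂ}

/-! ## §1 Identity theorem on `ℍ` -/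

/-- **Identity theorem on `ℍ`.**  Two holomorphic functions on `ℍ` agreeing in a neighbourhood of one point agree everywhere. [folklore] -/
theorem eq_of_eventuallyEq (hF : MDifferentiable 𝓘(ℂ) 𝓘(ℂ) F) (hG : MDifferentiable 𝓘(ℂ) 𝓘(ℂ) G) {τ₀ : ℍ}
    (h : F =ᶠ[𝓝 τ₀] G) : F = G := by
  -- transfer to the open upper half-plane in `ℂ`
  have hF' : AnalyticOnNhd ℂ (F ∘ ofComplex) upperHalfPlaneSet :=
    (UpperHalfPlane.mdifferentiable_iff.mp hF).analyticOnNhd isOpen_upperHalfPlaneSet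
  have hG' : AnalyticOnNhd ℂ (G ∘ ofComplex) upperHalfPlaneSet :=
    (UpperHalfPlane.mdifferentiable_iff.mp hG).analyticOnNhd isOpen_upperHalfPlaneSet
  have hconn : IsPreconnected upperHalfPlaneSet := (convex_halfSpace_im_gt 0).isPreconnected
  have hz₀ : (τ₀ : ℂ) ∈ upperHalfPlaneSet := τ₀.im_pos
  have hev : (F ∘ ofComplex) =ᶠ[𝓝 (τ₀ : ℂ)] (G ∘ ofComplex) := by
    -- `ofComplex` is continuous at `↑τ₀` with value `τ₀`
    have hc : Tendsto (ofComplex : ℂ → ℍ) (𝓝 (τ₀ : ℂ)) (𝓝 τ₀) := by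
      have := (mdifferentiableAt_ofComplex (z := (τ₀ : ℂ)) τ₀.im_pos).continuousAt
      rw [ContinuousAt, ofComplex_apply] at this
      exact this
    exact hc.eventually h
  have hEq := hF'.eqOn_of_preconnected_of_eventuallyEq hG' hconn hz₀ hev
  funext τ
  have := hEq τ.im_pos
  simpa [Function.comp_apply, ofComplex_apply] using this

/-- Holomorphic functions agreeing off a closed set with empty interior agree everywhere. [folklore] -/
theorem eq_of_eqOn_compl (hF : MDifferentiable 𝓘(ℂ) 𝓘(ℂ) F) (hG : MDifferentiable 𝓘(ℂ) 𝓘(ℂ) G) {Z : Set ℍ}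
    (hZ : IsClosed Z) (hZi : interior Z = ∅) (h : EqOn F G Zᶜ) : F = G := by
  -- `Zᶜ` is open and nonempty
  have hne : (Zᶜ : Set ℍ).Nonempty := by
    by_contra hcon
    rw [Set.not_nonempty_iff_eq_empty, Set.compl_empty_iff] at hcon
    rw [hcon, interior_univ] at hZi
    exact Set.univ_nonempty.ne_empty hZi
  obtain ⟨τ₀, hτ₀⟩ := hne
  exact eq_of_eventuallyEq hF hG (Filter.eventuallyEq_of_mem (hZ.isOpen_compl.mem_nhds hτ₀) h)

/-- **Slash transport off a thin set.**  If `F` is holomorphic and `F ∣[k] g = ρ • F` off a closed set with empty interior, then everywhere. [folklore] -/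
theorem slash_eq_smul_of_eqOn_compl (hF : MDifferentiable 𝓘(ℂ) 𝓘(ℂ) F) (k : ℤ) (g : SL(2, ℤ)) (ρ : ℂ) {Z : Set ℍ}
    (hZ : IsClosed Z) (hZi : interior Z = ∅) (h : EqOn (F ∣[k] g) (ρ • F) Zᶜ) : F ∣[k] g = ρ • F := by
  have h1 : MDifferentiable 𝓘(ℂ) 𝓘(ℂ) (F ∣[k] g) := by
    rw [SL_slash]
    exact hF.slash k _
  have h2 : MDifferentiable 𝓘(ℂ) 𝓘(ℂ) (ρ • F) := by
    have : (ρ • F) = fun τ ↦ ρ * F τ := by funext τ; simp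
    rw [this]
    exact mdifferentiable_const.mul hF
  exact eq_of_eqOn_compl h1 h2 hZ hZi h

/-- The case `ρ = 1`. [folklore] -/
theorem slash_eq_self_of_eqOn_compl (hF : MDifferentiable 𝓘(ℂ) 𝓘(ℂ) F) (k : ℤ) (g : SL(2, ℤ)) {Z : Set ℍ}
    (hZ : IsClosed Z) (hZi : interior Z = ∅) (h : EqOn (F ∣[k] g) F Zᶜ) : F ∣[k] g = F := by
  have h' : EqOn (F ∣[k] g) ((1 : ℂ) • F) Zᶜ := by rwa [one_smul]
  have := slash_eq_smul_of_eqOn_compl hF k g 1 hZ hZi h'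
  rwa [one_smul] at this

/-! ## §2 Zero sets of holomorphic functions are thin -/

/-- The zero set of a continuous function on `ℍ` is closed. [folklore] -/
theorem isClosed_zeroSet {H : ℍ → ℂ} (hH : Continuous H) : IsClosed {τ : ℍ | H τ = 0} :=
  isClosed_eq hH continuous_const

/-- **The zero set of a holomorphic `H ≢ 0` on `ℍ` has empty interior.** [folklore] -/
theorem interior_zeroSet_eq_empty {H : ℍ → ℂ} (hH : MDifferentiable 𝓘(ℂ) 𝓘(ℂ) H) (hne : ∃ τ, H τ ≠ 0) :
    interior {τ : ℍ | H τ = 0} = ∅ := by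
  by_contra hcon
  obtain ⟨τ₀, hτ₀⟩ := Set.nonempty_iff_ne_empty.mpr hcon
  have hev : H =ᶠ[𝓝 τ₀] (fun _ ↦ (0 : ℂ)) :=
    Filter.eventuallyEq_of_mem (mem_interior_iff_mem_nhds.mp hτ₀) fun τ hτ ↦ hτ
  have h0 := eq_of_eventuallyEq hH mdifferentiable_const hev
  obtain ⟨τ, hτ⟩ := hne
  exact hτ (congr_fun h0 τ)

/-- The translated zero set `{τ | H (g • τ) = 0}` is the zero set of the holomorphic `H ∣[0] g`, hence again closed with empty interior when
`H ≢ 0`. [folklore] -/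
theorem zeroSet_smul {H : ℍ → ℂ} (g : SL(2, ℤ)) : {τ : ℍ | H (g • τ) = 0} = {τ : ℍ | (H ∣[(0 : ℤ)] g) τ = 0} := by
  ext τ
  simp only [Set.mem_setOf_eq, SL_slash_apply, neg_zero, zpow_zero, mul_one]

/-- `H ∣[0] g ≢ 0` when `H ≢ 0`. [folklore] -/
theorem exists_slash_zero_ne_zero {H : ℍ → ℂ} (g : SL(2, ℤ)) (hne : ∃ τ, H τ ≠ 0) : ∃ τ, (H ∣[(0 : ℤ)] g) τ ≠ 0 := by
  obtain ⟨τ, hτ⟩ := hne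
  refine ⟨g⁻¹ • τ, ?_⟩
  rw [SL_slash_apply, neg_zero, zpow_zero, mul_one, smul_inv_smul]
  exact hτ

/-- Closedness and thinness of `{τ | H (g • τ) = 0}`. [folklore] -/
theorem isClosed_zeroSet_smul {H : ℍ → ℂ} (hH : MDifferentiable 𝓘(ℂ) 𝓘(ℂ) H) (g : SL(2, ℤ)) : IsClosed {τ : ℍ | H (g • τ) = 0} := by
  rw [zeroSet_smul]
  have h1 : MDifferentiable 𝓘(ℂ) 𝓘(ℂ) (H ∣[(0 : ℤ)] g) := by rw [SL_slash]; exact hH.slash 0 _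
  exact isClosed_zeroSet h1.continuous

/-- [folklore] -/
theorem interior_zeroSet_smul_eq_empty {H : ℍ → ℂ} (hH : MDifferentiable 𝓘(ℂ) 𝓘(ℂ) H) (hne : ∃ τ, H τ ≠ 0) (g : SL(2, ℤ)) :
    interior {τ : ℍ | H (g • τ) = 0} = ∅ := by
  rw [zeroSet_smul]
  have h1 : MDifferentiable 𝓘(ℂ) 𝓘(ℂ) (H ∣[(0 : ℤ)] g) := by rw [SL_slash]; exact hH.slash 0 _
  exact interior_zeroSet_eq_empty h1 (exists_slash_zero_ne_zero g hne)

/-- Finite unions of closed thin sets are thin. [folklore] -/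
theorem interior_union_eq_empty {X : Type*} [TopologicalSpace X] {Z₁ Z₂ : Set X} (h₁ : IsClosed Z₁) (hi₁ : interior Z₁ = ∅)
    (hi₂ : interior Z₂ = ∅) : interior (Z₁ ∪ Z₂) = ∅ := by
  rw [interior_union_isClosed_of_interior_empty h₁ hi₂, hi₁]

/-- **Packaged for (INV).**  If `F` is holomorphic on `ℍ`, `H ≢ 0` is holomorphic on `ℍ`, and `F ∣[k] g = ρ • F` holds at every `τ` with `H τ ≠ 0` and
`H (g • τ) ≠ 0`, then `F ∣[k] g = ρ • F`. [folklore] -/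
theorem slash_eq_smul_of_forall_ne_zero (hF : MDifferentiable 𝓘(ℂ) 𝓘(ℂ) F) (k : ℤ) (g : SL(2, ℤ)) (ρ : ℂ) {H : ℍ → ℂ}
    (hH : MDifferentiable 𝓘(ℂ) 𝓘(ℂ) H) (hne : ∃ τ, H τ ≠ 0)
    (h : ∀ τ : ℍ, H τ ≠ 0 → H (g • τ) ≠ 0 → (F ∣[k] g) τ = ρ * F τ) : F ∣[k] g = ρ • F := by
  set Z : Set ℍ := {τ : ℍ | H τ = 0} ∪ {τ : ℍ | H (g • τ) = 0} with hZ
  have hZc : IsClosed Z := (isClosed_zeroSet hH.continuous).union (isClosed_zeroSet_smul hH g)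
  have hZi : interior Z = ∅ :=
    interior_union_eq_empty (isClosed_zeroSet hH.continuous) (interior_zeroSet_eq_empty hH hne) (interior_zeroSet_smul_eq_empty hH hne g)
  refine slash_eq_smul_of_eqOn_compl hF k g ρ hZc hZi fun τ hτ ↦ ?_
  simp only [hZ, Set.mem_compl_iff, Set.mem_union, Set.mem_setOf_eq, not_or] at hτ
  rw [Pi.smul_apply, smul_eq_mul]
  exact h τ hτ.1 hτ.2

end Summit.BirchSwinnertonDyer.BirchSwinnertonDyer.Theorems.ManinLocalTwoThree.HolomorphicIdentity

end
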